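import Summits.CriticalPhenomena.CardyFormulaZ2.Theorems.CardyComplexConeParafermionToSLESixFamiliesDiamondDefs
import HarnessLib

/-!
# Line `potential-darboux-picard-diamond`, stub S4′ (`stub_identifyPotentialPh`): closed rays and the limit form of (DIR)

Helper file of the stub `stub_identifyPotentialPh` of crux `ParafermionToSLESixFamilies` (stmt-CriticalPhenomena-11389).
Step (ii′) of the identification ("DIR in the limit") passes from the lattice statement (DIR) of `ExactPotentialTracePh`
— the renormalised increments `δ^{2/3}(Ψ f′ − Ψ f)` between ordered side cells stay within `C δ^{2/3}` of the closed ray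
`ℝ≥0 · u(δ) τ(p,q)` (`rayDist`, with the unimodular phase anchor `u δ`) — to the statement that the potential limit `G`
moves weakly monotonically along `u⋆ τ(p,q)` on the boundary segment `[p, q]`, `u⋆` a subsequential limit of the
anchors. This file proves the three elementary facts about `rayDist` consumed there:

* `mem_ray_iff`, `isClosed_ray`, `rayDist_eq_zero_iff` — the closed ray `ℝ≥0·τ` is closed, so `rayDist τ x = 0` iff
  `x = t τ`, `t ≥ 0`; `rayDist_unit_mul` — a unimodular factor on the direction is a rotation of the point;
* `mem_ray_of_tendsto_rayDist` (registered helper of the crux item) — if `x_k → x`, the anchors `u_k → u⋆` are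
  unimodular and `rayDist (u_k τ) x_k ≤ ε_k → 0`, then `x = t · u⋆ τ` with `t ≥ 0`;
* `sub_mem_ray_of_Ioo` — weak monotonicity along a direction `d` of a function continuous on a segment passes from
  pairs of interior parameters `0 < s < s′ < L` to all pairs `0 ≤ s ≤ s′ ≤ L` (the trimmed side cells of (DIR) only see
  the open segment; continuity of `G` on the closed diamond bridges the corners).
-/

noncomputable section

namespace Summit.CriticalPhenomena.CardyFormulaZ2.Cruxes.ParafermionToSLESixFamilies.PotentialDarbouxPicardDiamond

open scoped Topology ComplexConjugate
open Filter Set Metric Complex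

/-! ## The closed ray `ℝ≥0 · τ` -/

/-- Membership in the closed ray `ℝ≥0·τ` (`τ ≠ 0`) is the closed condition `x conj τ ∈ ℝ≥0`. -/
theorem mem_ray_iff {τ : ℂ} (hτ : τ ≠ 0) (x : ℂ) :
    x ∈ (fun t : ℝ => (t : ℂ) * τ) '' Ici 0 ↔ (x * conj τ).im = 0 ∧ 0 ≤ (x * conj τ).re := by
  constructor
  · rintro ⟨t, ht, rfl⟩
    rw [mul_assoc, mul_conj, ← ofReal_mul, ofReal_im, ofReal_re]
    exact ⟨rfl, mul_nonneg ht (normSq_nonneg τ)⟩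
  · rintro ⟨him, hre⟩
    have hns : 0 < normSq τ := normSq_pos.2 hτ
    refine ⟨(x * conj τ).re / normSq τ, div_nonneg hre hns.le, ?_⟩
    have hreal : ((x * conj τ).re : ℂ) = x * conj τ := by
      conv_rhs => rw [← re_add_im (x * conj τ), him]
      simp
    have hns' : (normSq τ : ℂ) ≠ 0 := by exact_mod_cast hns.ne'
    show (((x * conj τ).re / normSq τ : ℝ) : ℂ) * τ = x
    rw [ofReal_div, hreal, div_mul_eq_mul_div, mul_assoc, ← normSq_eq_conj_mul_self, mul_div_assoc,
      div_self hns', mul_one]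

/-- The closed ray `ℝ≥0·τ` is a closed set. -/
theorem isClosed_ray (τ : ℂ) : IsClosed ((fun t : ℝ => (t : ℂ) * τ) '' Ici 0) := by
  by_cases hτ : τ = 0
  · have : (fun t : ℝ => (t : ℂ) * τ) '' Ici 0 = {0} := by
      refine Subset.antisymm ?_ fun x hx => ⟨0, self_mem_Ici, ?_⟩
      · rintro _ ⟨t, -, rfl⟩
        simp [hτ]
      · rw [mem_singleton_iff.1 hx]; simp
    rw [this]
    exact isClosed_singleton
  · have hset : (fun t : ℝ => (t : ℂ) * τ) '' Ici 0 = {x : ℂ | (x * conj τ).im = 0 ∧ 0 ≤ (x * conj τ).re} := by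
      ext x; exact mem_ray_iff hτ x
    rw [hset]
    have hc : Continuous fun x : ℂ => x * conj τ := continuous_id.mul continuous_const
    exact (isClosed_eq (continuous_im.comp hc) continuous_const).inter
      (isClosed_le continuous_const (continuous_re.comp hc))

/-- `rayDist τ x = 0` iff `x` lies on the closed ray: `x = t τ` with `t ≥ 0`. -/
theorem rayDist_eq_zero_iff (τ x : ℂ) : rayDist τ x = 0 ↔ ∃ t : ℝ, 0 ≤ t ∧ x = t * τ := by
  have hne : ((fun t : ℝ => (t : ℂ) * τ) '' Ici 0).Nonempty := ⟨0, 0, self_mem_Ici, by simp⟩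
  unfold rayDist
  rw [← (isClosed_ray τ).mem_iff_infDist_zero hne]
  constructor
  · rintro ⟨t, ht, rfl⟩; exact ⟨t, ht, rfl⟩
  · rintro ⟨t, ht, rfl⟩; exact ⟨t, ht, rfl⟩

/-- `rayDist τ` is `1`-Lipschitz in the point. -/
theorem rayDist_le_rayDist_add_dist (τ x y : ℂ) : rayDist τ x ≤ rayDist τ y + dist x y :=
  infDist_le_infDist_add_dist

/-- A unimodular factor on the direction is a rotation of the point: `rayDist (u τ) x = rayDist τ (conj u · x)`. -/
theorem rayDist_unit_mul {u : ℂ} (hu : ‖u‖ = 1) (τ x : ℂ) : rayDist (u * τ) x = rayDist τ (conj u * x) := by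
  have hiso : Isometry fun z : ℂ => u * z :=
    Isometry.of_dist_eq fun a b => by rw [dist_eq_norm, dist_eq_norm, ← mul_sub, norm_mul, hu, one_mul]
  have huu : u * (conj u * x) = x := by
    rw [← mul_assoc, mul_conj, normSq_eq_norm_sq, hu]; simp
  have himg : (fun t : ℝ => (t : ℂ) * (u * τ)) '' Ici 0 = (fun z : ℂ => u * z) '' ((fun t : ℝ => (t : ℂ) * τ) '' Ici 0) := by
    rw [image_image]
    refine image_congr fun t _ => ?_
    ring
  unfold rayDist
  rw [himg, ← huu, infDist_image hiso, huu]

/-- **The limit form of (DIR).** If `x_k → x`, the anchors `u_k → u⋆` are unimodular, and the distance from `x_k` to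
the closed ray `ℝ≥0 · u_k τ` is at most `ε_k → 0` for all large `k`, then `x` lies on the closed ray `ℝ≥0 · u⋆ τ`. -/
theorem mem_ray_of_tendsto_rayDist : ∀ (τ : ℂ) (u : ℕ → ℂ) (ulim : ℂ) (x : ℕ → ℂ) (xlim : ℂ) (ε : ℕ → ℝ), (∀ k, ‖u k‖ = 1) → Tendsto u atTop (𝓝 ulim) → Tendsto x atTop (𝓝 xlim) → Tendsto ε atTop (𝓝 0) → (∀ᶠ k in atTop, rayDist (u k * τ) (x k) ≤ ε k) → ∃ t : ℝ, 0 ≤ t ∧ xlim = t * (ulim * τ) := by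
  intro τ u ulim x xlim ε hu hul hxl hε hdist
  -- the limit anchor is unimodular
  have hulim : ‖ulim‖ = 1 := by
    have h1 : Tendsto (fun k => ‖u k‖) atTop (𝓝 ‖ulim‖) := hul.norm
    have h2 : Tendsto (fun k => ‖u k‖) atTop (𝓝 1) := by simp only [hu]; exact tendsto_const_nhds
    exact tendsto_nhds_unique h1 h2
  -- rotate the points instead of the directions
  set y : ℕ → ℂ := fun k => conj (u k) * x k with hy
  have hyl : Tendsto y atTop (𝓝 (conj ulim * xlim)) :=
    ((continuous_conj.tendsto ulim).comp hul).mul hxl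
  have hdist' : ∀ᶠ k in atTop, rayDist τ (y k) ≤ ε k := by
    filter_upwards [hdist] with k hk
    rwa [rayDist_unit_mul (hu k)] at hk
  -- `rayDist τ` is continuous, so the limit point is on the ray
  have hcont : Continuous fun z : ℂ => rayDist τ z := by
    refine continuous_iff_continuousAt.2 fun z => ?_
    refine Metric.continuousAt_iff.2 fun e he => ⟨e, he, fun w hw => ?_⟩
    rw [Real.dist_eq, abs_lt]
    have h1 := rayDist_le_rayDist_add_dist τ w z
    have h2 := rayDist_le_rayDist_add_dist τ z w
    rw [dist_comm] at h2
    constructor <;> linarith [mem_ball.1 hw]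
  have hT : Tendsto (fun k => rayDist τ (y k)) atTop (𝓝 (rayDist τ (conj ulim * xlim))) :=
    (hcont.tendsto _).comp hyl
  have hle : rayDist τ (conj ulim * xlim) ≤ 0 :=
    le_of_tendsto_of_tendsto hT hε hdist'
  have hzero : rayDist τ (conj ulim * xlim) = 0 := le_antisymm hle infDist_nonneg
  obtain ⟨t, ht, hteq⟩ := (rayDist_eq_zero_iff τ _).1 hzero
  refine ⟨t, ht, ?_⟩
  have huu : ulim * (conj ulim * xlim) = xlim := by
    rw [← mul_assoc, mul_conj, normSq_eq_norm_sq, hulim]; simp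
  rw [← huu, hteq]; ring

/-! ## From the open to the closed segment -/

/-- **Weak monotonicity extends from the open to the closed parameter interval.** If `G` is continuous on the segment
`{p + s σ | 0 ≤ s ≤ L}` and `G(p + s′σ) − G(p + sσ)` lies on the closed ray `ℝ≥0·d` whenever `0 < s < s′ < L`, then the
same holds whenever `0 ≤ s ≤ s′ ≤ L`. -/
theorem sub_mem_ray_of_Ioo (G : ℂ → ℂ) (p σ d : ℂ) (L : ℝ)
    (hG : ContinuousOn (fun s : ℝ => G (p + (s : ℂ) * σ)) (Icc 0 L))
    (h : ∀ s s' : ℝ, 0 < s → s < s' → s' < L → ∃ r : ℝ, 0 ≤ r ∧ G (p + (s' : ℂ) * σ) - G (p + (s : ℂ) * σ) = r * d) :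
    ∀ s s' : ℝ, 0 ≤ s → s ≤ s' → s' ≤ L →
      ∃ r : ℝ, 0 ≤ r ∧ G (p + (s' : ℂ) * σ) - G (p + (s : ℂ) * σ) = r * d := by
  intro s s' hs hss' hs'
  rcases hss'.eq_or_lt with rfl | hlt
  · exact ⟨0, le_rfl, by simp⟩
  -- approximate from inside: `s_n = s + η_n`, `s'_n = s' - η_n`, `η_n = (s' - s)/(n + 3)`
  set g : ℝ → ℂ := fun s => G (p + (s : ℂ) * σ) with hg
  set η : ℕ → ℝ := fun n => (s' - s) / ((n : ℝ) + 3) with hη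
  have hηpos : ∀ n, 0 < η n := fun n => by simp only [hη]; positivity
  have hηlt : ∀ n, 2 * η n < s' - s := fun n => by
    simp only [hη]
    have hn : (0:ℝ) ≤ n := n.cast_nonneg
    rw [mul_div_assoc', div_lt_iff₀ (by positivity)]
    nlinarith
  have hη0 : Tendsto η atTop (𝓝 0) := by
    have h1 : Tendsto (fun n : ℕ => (n : ℝ) + 3) atTop atTop :=
      tendsto_atTop_add_const_right _ _ tendsto_natCast_atTop_atTop
    simpa [hη] using tendsto_const_nhds.div_atTop h1
  have hmem : ∀ n, g (s' - η n) - g (s + η n) ∈ (fun t : ℝ => (t : ℂ) * d) '' Ici 0 := by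
    intro n
    obtain ⟨r, hr, hreq⟩ := h (s + η n) (s' - η n) (by linarith [hηpos n]) (by linarith [hηlt n])
      (by linarith [hηpos n])
    refine ⟨r, hr, ?_⟩
    simp only [hg]
    push_cast at hreq ⊢
    exact hreq.symm
  -- continuity of `g` at `s` and `s'` within `[0, L]`
  have hts : Tendsto (fun n => g (s + η n)) atTop (𝓝 (g s)) := by
    have h1 : Tendsto (fun n => s + η n) atTop (𝓝[Icc 0 L] s) := by
      refine tendsto_nhdsWithin_iff.2 ⟨by simpa using tendsto_const_nhds.add hη0, Eventually.of_forall fun n => ?_⟩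
      exact ⟨by linarith [hηpos n], by linarith [hηlt n, hηpos n]⟩
    exact (hG s ⟨hs, hss'.trans hs'⟩).tendsto.comp h1
  have hts' : Tendsto (fun n => g (s' - η n)) atTop (𝓝 (g s')) := by
    have h1 : Tendsto (fun n => s' - η n) atTop (𝓝[Icc 0 L] s') := by
      refine tendsto_nhdsWithin_iff.2 ⟨by simpa using tendsto_const_nhds.sub hη0, Eventually.of_forall fun n => ?_⟩
      exact ⟨by linarith [hηlt n, hηpos n], by linarith [hηpos n]⟩
    exact (hG s' ⟨hs.trans hss', hs'⟩).tendsto.comp h1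
  have hlim : g s' - g s ∈ (fun t : ℝ => (t : ℂ) * d) '' Ici 0 :=
    (isClosed_ray d).mem_of_tendsto (hts'.sub hts) (Eventually.of_forall hmem)
  obtain ⟨r, hr, hreq⟩ := hlim
  exact ⟨r, hr, hreq.symm⟩

end Summit.CriticalPhenomena.CardyFormulaZ2.Cruxes.ParafermionToSLESixFamilies.PotentialDarbouxPicardDiamond

end
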